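import Literature.NumberTheory.LFunctions.HardyZRiemannSiegelEvaluationSharp
import Literature.NumberTheory.LFunctions.RiemannHypothesisUpToRSCertificate
import HarnessLib

/-!
# The Turing-method run checker on the SHARP proved Riemann–Siegel remainder (rational constants)

Topic `Literature/NumberTheory/LFunctions`. The run checker of `RiemannHypothesisUpToRSCertificate.lean`
(`RSCert.checkChunk`, conditional on `Gabcke.satz322b_R0`) re-targeted at the evaluator
`Literature.NumberTheory.LFunctions.RSEval.hardyZBoxS` (`HardyZRiemannSiegelEvaluationSharp.lean`), whose
remainder term is the tree's PROVED sharp bound `Gabcke.abs_R0_le_sharp_rat`; every soundness theorem is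
free of named-fact hypotheses. Same certificate format (blocks `(N, gaps)`, `N = 0` Euler–Maclaurin,
`N ≥ 1` Riemann–Siegel); the run algebra, `checkHnum` and `zetaZerosSimpleOnLineUpTo_of_runs` of the
original file are used as they are. Sibling of `RiemannHypothesisUpToRSCertificateExplicit.lean` (crude
explicit bound, `checkChunkX`), with a remainder radius `× 0.52`.

* `signRSS`, `signAtS`, `checkGapsS`, `checkBlocksS`, `checkChunkS`, `checkStartS`; soundness
  `sgnZ_of_signRSS`, `altRun_of_checkChunkS`, `sgnZ_of_checkStartS`.

## References

* W. Gabcke, Dissertation Göttingen 1979, Satz 3.2.2. [Gabcke1979]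
* R. P. Brent, Math. Comp. 33 (1979), §3–§4. [Brent1979]
* H. M. Edwards, *Riemann's Zeta Function* (1974), §6.5, §8.2. [EdwardsZeta1974]
-/

open Finset Complex
open Literature.Analysis.ValidatedNumerics Literature.Analysis.ValidatedNumerics.NumericsMP
open Literature.NumberTheory.LFunctions Literature.NumberTheory.LFunctions.ZetaNumerics
open Literature.NumberTheory.LFunctions.RSEval
open scoped Real

namespace Literature.NumberTheory.LFunctions

/-! ## The run checker on `hardyZBoxS` -/

namespace RSCert

/-- The sign of `Z(p/2^e)` from `hardyZBoxS R p e N` (`some true`: positive, `some false`: negative,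
`none`: undecided). [cite: Gabcke1979, Satz 3.2.2 p. 55] -/
def signRSS (R : RSTables) (e p N : ℕ) : Option Bool :=
  match hardyZBoxS R p e N with
  | some B => if 0 < B.lo then some true else if B.hi < 0 then some false else none
  | none => none

/-- Soundness of `signRSS` — no named fact. [cite: Gabcke1979, Satz 3.2.2 p. 55] -/
theorem sgnZ_of_signRSS {R : RSTables} (hR : R.Valid) {e p N : ℕ} {s : Bool}
    (h : signRSS R e p N = some s) : sgnZ e p s := by
  unfold signRSS at h
  split at h
  · rename_i B hB
    have hm := mem_hardyZBoxS hR hB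
    split_ifs at h with h1 h2
    · simp only [Option.some.injEq] at h
      subst h
      simpa [sgnZ] using MI.pos_of_lo_pos hm h1
    · simp only [Option.some.injEq] at h
      subst h
      simpa [sgnZ] using MI.neg_of_hi_neg hm h2
  · simp at h

/-- The sign of `Z(p/2^e)` by the method with code `N`: `N = 0` Euler–Maclaurin (`signEM`), `N ≥ 1`
Riemann–Siegel with the sharp proved remainder (`signRSS`). [cite: Gabcke1979, Satz 3.2.2 p. 55] -/
def signAtS (R : RSTables) (T : Tables) (e N p : ℕ) : Option Bool :=
  if N = 0 then signEM R T e p else signRSS R e p N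

/-- Soundness of `signAtS` — no named fact. [cite: Gabcke1979, Satz 3.2.2 p. 55] -/
theorem sgnZ_of_signAtS {R : RSTables} (hR : R.Valid) {T : Tables} (hT : T.Valid) {e N p : ℕ}
    {s : Bool} (h : signAtS R T e N p = some s) : sgnZ e p s := by
  unfold signAtS at h
  split_ifs at h
  · exact sgnZ_of_signEM hR hT h
  · exact sgnZ_of_signRSS hR h

/-- Check one block of gaps with method code `N` (as `checkGaps`, signs by `signAtS`). [cite: Brent1979, §3] -/
def checkGapsS (R : RSTables) (T : Tables) (e N : ℕ) : ℕ → Bool → List ℕ → Option (ℕ × Bool)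
  | p, s, [] => some (p, s)
  | p, s, g :: gs =>
    if 0 < g ∧ signAtS R T e N (p + g) = some (!s) then checkGapsS R T e N (p + g) (!s) gs else none

/-- Check a list of blocks `(N, gaps)` (as `checkBlocks`, signs by `signAtS`). [cite: Brent1979, §3] -/
def checkBlocksS (R : RSTables) (T : Tables) (e : ℕ) : ℕ → Bool → List (ℕ × List ℕ) → Option (ℕ × Bool)
  | p, s, [] => some (p, s)
  | p, s, (N, gs) :: bs =>
    match checkGapsS R T e N p s gs with
    | some (p', s') => checkBlocksS R T e p' s' bs
    | none => none

/-- Soundness of `checkGapsS` — no named fact. [cite: Brent1979, §3] -/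
theorem altRun_of_checkGapsS {R : RSTables} (hR : R.Valid) {T : Tables} (hT : T.Valid) {e N : ℕ} :
    ∀ (gs : List ℕ) (p : ℕ) (s : Bool) {p' : ℕ} {s' : Bool},
    sgnZ e p s → checkGapsS R T e N p s gs = some (p', s') →
      AltRun e p s gs ∧ p + gs.sum = p' ∧ sgnZ e p' s'
  | [], p, s, p', s', hp, h => by
    simp only [checkGapsS, Option.some.injEq, Prod.mk.injEq] at h
    obtain ⟨rfl, rfl⟩ := h
    exact ⟨hp, by simp, hp⟩
  | g :: gs, p, s, p', s', hp, h => by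
    simp only [checkGapsS] at h
    split_ifs at h with hc
    obtain ⟨hg, hsg⟩ := hc
    have hnext := sgnZ_of_signAtS hR hT hsg
    obtain ⟨hrun, hsum, hlast⟩ := altRun_of_checkGapsS hR hT gs (p + g) (!s) hnext h
    exact ⟨⟨hp, hg, hrun⟩, by simp [List.sum_cons, ← hsum, add_assoc], hlast⟩

/-- Soundness of `checkBlocksS` — no named fact. [cite: Brent1979, §3] -/
theorem altRun_of_checkBlocksS {R : RSTables} (hR : R.Valid) {T : Tables} (hT : T.Valid) {e : ℕ} :
    ∀ (bs : List (ℕ × List ℕ)) (p : ℕ) (s : Bool) {p' : ℕ} {s' : Bool},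
    sgnZ e p s → checkBlocksS R T e p s bs = some (p', s') →
      AltRun e p s (flatten bs) ∧ p + (flatten bs).sum = p' ∧ sgnZ e p' s'
  | [], p, s, p', s', hp, h => by
    simp only [checkBlocksS, Option.some.injEq, Prod.mk.injEq] at h
    obtain ⟨rfl, rfl⟩ := h
    exact ⟨by simpa [flatten, AltRun] using hp, by simp [flatten], hp⟩
  | (N, gs) :: bs, p, s, p', s', hp, h => by
    simp only [checkBlocksS] at h
    split at h
    · rename_i p₁ s₁ h₁
      obtain ⟨hrun₁, hsum₁, hlast₁⟩ := altRun_of_checkGapsS hR hT gs p s hp h₁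
      obtain ⟨hrun₂, hsum₂, hlast₂⟩ := altRun_of_checkBlocksS hR hT bs p₁ s₁ hlast₁ h
      refine ⟨?_, ?_, hlast₂⟩
      · simp only [flatten]
        exact altRun_append hrun₁ (hsum₁ ▸ hrun₂)
      · simp [flatten, List.sum_append, ← hsum₂, ← hsum₁, add_assoc]
    · simp at h

/-- **The chunk check with the sharp proved remainder**, tables built inside (`rsTablesWith Nrs`,
Euler–Maclaurin tables of cut-off `Nem` and order `ν`, scale `2^60`). Same certificate format as
`checkChunk`. [cite: Brent1979, §3] -/
def checkChunkS (Nrs Nem nu e p : ℕ) (s : Bool) (bs : List (ℕ × List ℕ)) : Option (ℕ × Bool) :=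
  match rsTablesWith Nrs, RHUpToCert.tablesWith Nem nu with
  | some R, some T => checkBlocksS R T e p s bs
  | _, _ => none

/-- **The start check with the sharp proved remainder**. [cite: Brent1979, §3] -/
def checkStartS (Nrs Nem nu e N p : ℕ) (s : Bool) : Bool :=
  match rsTablesWith Nrs, RHUpToCert.tablesWith Nem nu with
  | some R, some T => decide (signAtS R T e N p = some s)
  | _, _ => false

/-- Soundness of `checkStartS` — no named fact. [cite: Brent1979, §3] -/
theorem sgnZ_of_checkStartS {Nrs Nem nu e N p : ℕ} {s : Bool}
    (h : checkStartS Nrs Nem nu e N p s = true) : sgnZ e p s := by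
  unfold checkStartS at h
  split at h
  · rename_i R T hR hT
    exact sgnZ_of_signAtS (rsTablesWith_valid hR) (RHUpToCert.tablesWith_valid hT) (of_decide_eq_true h)
  · simp at h

/-- **Soundness of the chunk check with the sharp proved remainder — no named fact**: from a certified
sign `s` at `p` and `checkChunkS … p s bs = some (p', s')`, the gaps form a run from `p` ending at `p'`
with certified sign `s'`; feed the runs to `zetaZerosSimpleOnLineUpTo_of_runs`.
[cite: Brent1979, §3 Theorems 3.1–3.2] -/
theorem altRun_of_checkChunkS {Nrs Nem nu e p : ℕ} {s : Bool}
    {bs : List (ℕ × List ℕ)} {p' : ℕ} {s' : Bool} (hp : sgnZ e p s)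
    (h : checkChunkS Nrs Nem nu e p s bs = some (p', s')) :
    AltRun e p s (flatten bs) ∧ p + (flatten bs).sum = p' ∧ sgnZ e p' s' := by
  unfold checkChunkS at h
  split at h
  · rename_i R T hR hT
    exact altRun_of_checkBlocksS (rsTablesWith_valid hR) (RHUpToCert.tablesWith_valid hT) bs p s hp h
  · simp at h

end RSCert

end Literature.NumberTheory.LFunctions
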